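import Literature.Computability.AlgebraicComplexity.PerDetHwvCertificateSemantics
import HarnessLib

/-!
# The toy certificate as a theorem: end-to-end check of the Lean certificate pipeline

Lean checker of the GCT multiplicity-obstruction engine (cell `pub-gct`; honest framing: rung-1
multiplicity-obstruction search for permanent versus determinant at small `(n, m)`, no claim about
VP ≠ VNP or P ≠ NP). The toy certificate `toyCert` of `PerDetHwvCertificate.lean`
(`(n, m, d, λ) = (2, 2, 2, (2,2))`, one tableau functional, one integer point, kernel-verified
by `toyCert_verify`) is turned into a THEOREM of the tree by the unconditional glue
`Cert.le_orbitMultiplicity` (`PerDetHwvCertificateSemantics.lean`):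

  `1 ≤ mult_{(2,2)^*} ℂ[Δ(per₂)]` — the irreducible of highest weight `(2,2)^*` OCCURS in the
  degree-2 coordinate ring of the orbit closure of the `2 × 2` permanent.

Mathematically a triviality (per₂ ≅ det₂; no obstruction is claimed, `sk` plays no role); its
point is that every step — tableau functional, evaluation at `g · per₂` in the kernel, polarisation,
highest-weight property, orbit-closure membership, rank bound — is now checked by the kernel with
the standard axioms only (no `native_decide`). [folklore]
-/

namespace Literature.Computability.AlgebraicComplexity

namespace TableauEval

open _root_.Literature.NumberTheory.DiophantineGeometry

/-- The toy certificate uses the engine's canonical alternators. [folklore] -/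
theorem toyCert_canonical : toyCert.canonical = true := by decide +kernel

/-- **The toy certificate is a theorem**: `V_{(2,2)}^*` occurs in `ℂ[Δ(per₂)]₂`, i.e.
`toyCert.r = 1 ≤ orbitMultiplicity ℂ (paddedPerFormLex ℂ 2 2) 2 (2,2)^*` — kernel-verified
certificate ⇒ `Cert.le_orbitMultiplicity`. [folklore] -/
theorem toyCert_bound :
    haveI : NeZero toyCert.m := ⟨by decide⟩
    toyCert.r ≤ orbitMultiplicity ℂ (paddedPerFormLex ℂ toyCert.n toyCert.m) toyCert.m
      (toyCert.weight (toyCert.lam_pos_of_verify toyCert_verify)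
        (toyCert.lam_sum_of_verify toyCert_verify)) :=
  haveI : NeZero toyCert.m := ⟨by decide⟩
  toyCert.le_orbitMultiplicity toyCert_verify toyCert_canonical

end TableauEval

end Literature.Computability.AlgebraicComplexity
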